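import Literature.MathematicalPhysics.QuantumFieldTheory.Balaban1983to89.Node00.OpsYCubeKnitPar
import Literature.MathematicalPhysics.QuantumFieldTheory.Balaban1983to89.B9B8KnitLetterCovariance

/-!
# `Node00.OpsYCubeKnitParCovariance` — THE KNIT TABLE AT AN ARBITRARY LEVEL FUNCTION TRANSFORMS AS A CONTOUR VARIABLE ((3.28)), AND SO DOES ITS CUBE INSTANCE `parKnitCubeY i □`

[Balaban1985BackgroundPropagators] p. 395 (before (3.32)): under a gauge transformation `U ↦ U^u` the contour variables transform as
`R(U^u(Γ^{(j)}_{y,x})) = R(u(y)) R(U(Γ^{(j)}_{y,x})) R(u⁻¹(x))`, which gives the covariance (3.28) of `Δ′_a(U)`, `Q′(U)`, `G′(U)` ((3.31)–(3.33)) and,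
for the cube sequence `{Ω_n(□)}` of p. 408, of `Δ′_{a,□}(U)`, `G_□(U)` ∕ `G′_□(U)` (Cor. 3.6 p. 408: «gauge invariant»).

WHY THIS FILE (by-name need of the N06 junction, dag-n06-c g32, 2026-08-31T13:53Z).  `B9B8KnitLetterCovariance` proved the law for def-Y's MEMBER-level
letter `parKnitY i` (`knitT_liftCfg_gaugeY`, `parKnitY_gaugeY_of_corner_left∕right`, `avgTrY_parKnitY_gaugeY`).  The `U ≠ 1` rows at a cover cube
read the CUBE-LEVEL letter `Node00.OpsYCubeKnitPar.parKnitCubeY i □ = parKnitLY i (levCubeY i □)`; the junction's covariance clauses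
(`deltaPrimeACubeY_cov_of_pairs`, `GpDirY_cov_of_pairs`, …) take the transporter law ON THE AVERAGING PAIRS (`avgCoeffCubeY i □ z w ≠ 0`) as their
`hpar`.  Here, with the SAME proofs read at an arbitrary level function `lv`:

* §1 ★ `knitTL_liftCfg_gaugeY` — `U^u(Γ^{(lv w)}_{y,w}) = u(c_{lv}(w))·U(Γ^{(lv w)}_{y,w})·u(w)⁻¹`, `c_{lv}(w)` the corner of the `L^{lv w}`-block of `w`
  (`B9B8KnitLetterCovariance.compT_bgT_gaugeAct` telescoped to the level `lv w`);
* §2 ★ `parKnitLY_gaugeY_of_corner_left∕right` (the law on the corner pairs `(c(w), w)` and `(z, c(z))`), ★★ `parKnitLY_corner_mul_gaugeY` (the law for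
  the averaging product through a shared corner);
* §3 the cube instance: `knitCubeY_gaugeY`, `parKnitCubeY_gaugeY_of_corner_left∕right`, ★★ `avgTrCubeY_parKnitCubeY_gaugeY` — ON THE SUPPORT OF THE
  CUBE COEFFICIENT the cube sequence's averaging transporter at `parKnitCubeY i □` is a contour variable:
  `avgTrCubeY i □ (parKnitCubeY i □) (U^u) z w = u(z) · avgTrCubeY i □ (parKnitCubeY i □) U z w · u(w)⁻¹` (the junction's `hpar`, by name).

Bookkeeping identities of print's (3.28) at the sequence `{Ω_n(□)}`; nothing analytic is claimed.
-/

noncomputable section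

namespace Literature.MathematicalPhysics.QuantumFieldTheory.Balaban1983to89.Node00.OpsYCubeKnitParCovariance

open Node00 B6KLevelCensusIndexV1 B6GlobalChartV1 B9BackgroundsKLevelV1 B9Eq39Adjoint
open B7Prop1Explicit (gaugeAct)
open B7AvgGaugeCovariance (uLev uLev_apply)
open Literature.MathematicalPhysics.QuantumLattice (blockMap blockBase)
open B4Reflection242 (blk)
open B6Cover236MultiLevelBlocks (cubes)
open B8Eq119TwistedAxial (bgT)
open B9B8CarrierDictionary (liftFun liftFun_apply liftCfg liftCfg_apply)
open B9B8AveragingKernelZd (compT)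
open B9B8AveragingJunction (blockMap_iterate blk_eq_blockMap)
open B9B8KnitVsTaxicab (boxEquiv_symm_eq_transl)
open B9B8KnitLetterCovariance (liftCfg_gaugeY compT_bgT_gaugeAct cornerY_val_eq_smul)
open B9CubeLettersOpsL0 (levCubeY avgCoeffCubeY avgTrCubeY)
open B9Thm311CubeLettersFirstThree (cornerY_eq_of_avgCoeffCubeY_ne_zero)
open Node00.OpsYCubeKnitPar (knitTL parOfTL parKnitLY parKnitCubeY knitCubeY)
open scoped Matrix

variable {d ℓ : ℕ} {hd : 1 ≤ d + 1} {hL : Odd (ℓ + 1) ∧ 1 < ℓ + 1} {b₀ b₁ : ℝ}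
variable {𝔸 : Type} [NormedRing 𝔸] [NormedAlgebra ℂ 𝔸] [CompleteSpace 𝔸]

/-! ## §1 The composite leg at the level `lv w` transforms as a contour variable -/

section Contour

variable (i : KIdx d ℓ hd hL b₀ b₁) (lv : SiteY i → ℕ)

/-- ★ **`U(Γ^{(lv w)}_{y,w})` TRANSFORMS AS A CONTOUR VARIABLE from the `L^{lv w}`-corner to the site**:
`knitTL lv [U^u](w) = u(c_{lv}(w))·knitTL lv [U](w)·u(w)⁻¹` (`B9B8KnitLetterCovariance.knitT_liftCfg_gaugeY` read at the level `lv w`).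
[cite: Balaban1985BackgroundPropagators, (3.19) p.393, p.395 (before (3.32)); Balaban1985Averaging, (52)–(53) p.27] -/
theorem knitTL_liftCfg_gaugeY (g : GaugeY 𝔸 i) (U : CfgY 𝔸 i) (w : SiteY i) :
    knitTL i lv (bgT (ℓ + 1) (liftCfg (gaugeY i g U))) w
      = gSiteY i g (cornerY i (lv w) w) * knitTL i lv (bgT (ℓ + 1) (liftCfg U)) w * (gSiteY i g w)⁻¹ := by
  have hb : blk ((ℓ + 1) ^ lv w) w.1 = (blockMap (ℓ + 1))^[lv w] w.1 := by
    rw [blockMap_iterate, blk_eq_blockMap]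
  unfold knitTL
  rw [liftCfg_gaugeY, hb, compT_bgT_gaugeAct, uLev_apply, ← hb]
  have h1 : liftFun g ((((ℓ + 1 : ℕ) : ℤ) ^ lv w) • blk ((ℓ + 1) ^ lv w) w.1) = gSiteY i g (cornerY i (lv w) w) := by
    show _ = g ((boxEquiv i.hN).symm (cornerY i (lv w) w))
    rw [boxEquiv_symm_eq_transl, cornerY_val_eq_smul, liftFun_apply]
  have h2 : liftFun g w.1 = gSiteY i g w := by
    show _ = g ((boxEquiv i.hN).symm w)
    rw [boxEquiv_symm_eq_transl, liftFun_apply]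
  rw [h1, h2]

end Contour

/-! ## §2 The letter `parKnitLY i lv` obeys the transporter law on corner pairs and through a shared corner -/

section Table

variable (i : KIdx d ℓ hd hL b₀ b₁) (lv : SiteY i → ℕ) (g : GaugeY 𝔸 i) (U : CfgY 𝔸 i)

/-- ★ the law on a corner pair `(c_{lv}(w), w)`: `τ(U^u; c(w), w) = u(c(w))·τ(U; c(w), w)·u(w)⁻¹`. [cite: Balaban1985BackgroundPropagators, (3.19) p.393, (3.28) p.395, p.395 (before (3.32))] -/
theorem parKnitLY_gaugeY_of_corner_left {z w : SiteY i} (h : cornerY i (lv w) w = z) :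
    parKnitLY i lv (gaugeY i g U) z w = gSiteY i g z * parKnitLY i lv U z w * (gSiteY i g w)⁻¹ := by
  show parOfTL i lv (bgT (ℓ + 1) (liftCfg (gaugeY i g U))) z w
    = gSiteY i g z * parOfTL i lv (bgT (ℓ + 1) (liftCfg U)) z w * (gSiteY i g w)⁻¹
  unfold parOfTL
  rw [if_pos h, if_pos h, knitTL_liftCfg_gaugeY, h]

/-- ★ the law on the reversed pair `(z, c_{lv}(z))` (the inverse leg of `Q′*`). [cite: Balaban1985BackgroundPropagators, (3.19) p.393, (3.24) p.394, (3.28) p.395] -/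
theorem parKnitLY_gaugeY_of_corner_right {z w : SiteY i} (h : cornerY i (lv z) z = w) :
    parKnitLY i lv (gaugeY i g U) z w = gSiteY i g z * parKnitLY i lv U z w * (gSiteY i g w)⁻¹ := by
  by_cases h' : cornerY i (lv w) w = z
  · exact parKnitLY_gaugeY_of_corner_left i lv g U h'
  · show parOfTL i lv (bgT (ℓ + 1) (liftCfg (gaugeY i g U))) z w
      = gSiteY i g z * parOfTL i lv (bgT (ℓ + 1) (liftCfg U)) z w * (gSiteY i g w)⁻¹
    unfold parOfTL
    rw [if_neg h', if_pos h, if_neg h', if_pos h, knitTL_liftCfg_gaugeY, h]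
    simp only [mul_inv_rev, inv_inv, mul_assoc]

/-- ★★ **THE AVERAGING PRODUCT THROUGH A SHARED CORNER IS A CONTOUR VARIABLE**: for `w` and `z` with one `L^{lv}`-corner `c`,
`τ(U^u; z, c)·τ(U^u; c, w) = u(z)·(τ(U; z, c)·τ(U; c, w))·u(w)⁻¹` — (3.28) for the transporter of the averaging term `Q′* 1 Q′` of (3.24) read at the
level function `lv`. [cite: Balaban1985BackgroundPropagators, (3.19) p.393, (3.24) p.394, (3.28) p.395] -/
theorem parKnitLY_corner_mul_gaugeY {z w : SiteY i} (hc : cornerY i (lv w) w = cornerY i (lv z) z) :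
    parKnitLY i lv (gaugeY i g U) z (cornerY i (lv z) z) * parKnitLY i lv (gaugeY i g U) (cornerY i (lv z) z) w
      = gSiteY i g z * (parKnitLY i lv U z (cornerY i (lv z) z) * parKnitLY i lv U (cornerY i (lv z) z) w) * (gSiteY i g w)⁻¹ := by
  rw [parKnitLY_gaugeY_of_corner_right i lv g U rfl, parKnitLY_gaugeY_of_corner_left i lv g U hc]
  simp only [mul_assoc, inv_mul_cancel_left]

end Table

/-! ## §3 The cube instance `parKnitCubeY i □` -/

section Cube

variable (i : KIdx d ℓ hd hL b₀ b₁) (q : ↥(cubes (toKT i).D.toDomains)) (g : GaugeY 𝔸 i) (U : CfgY 𝔸 i)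

/-- ★ the cube sequence's knit leg transforms as a contour variable from the `lev_□`-corner: `U^u(Γ^{(lev_□ w)}_{y,w}) = u(c_□(w))·U(Γ^{(lev_□ w)}_{y,w})·u(w)⁻¹`.
[cite: Balaban1985BackgroundPropagators, (3.19) p.393, p.395 (before (3.32)), p.409] -/
theorem knitCubeY_gaugeY (w : SiteY i) :
    knitCubeY i q (gaugeY i g U) w = gSiteY i g (cornerY i (levCubeY i q w) w) * knitCubeY i q U w * (gSiteY i g w)⁻¹ :=
  knitTL_liftCfg_gaugeY i _ g U w

/-- ★ the law on a `lev_□`-corner pair `(c_□(w), w)`. [cite: Balaban1985BackgroundPropagators, (3.19) p.393, (3.28) p.395, p.409] -/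
theorem parKnitCubeY_gaugeY_of_corner_left {z w : SiteY i} (h : cornerY i (levCubeY i q w) w = z) :
    parKnitCubeY i q (gaugeY i g U) z w = gSiteY i g z * parKnitCubeY i q U z w * (gSiteY i g w)⁻¹ :=
  parKnitLY_gaugeY_of_corner_left i _ g U h

/-- ★ the law on the reversed pair `(z, c_□(z))`. [cite: Balaban1985BackgroundPropagators, (3.19) p.393, (3.24) p.394, (3.28) p.395, p.409] -/
theorem parKnitCubeY_gaugeY_of_corner_right {z w : SiteY i} (h : cornerY i (levCubeY i q z) z = w) :
    parKnitCubeY i q (gaugeY i g U) z w = gSiteY i g z * parKnitCubeY i q U z w * (gSiteY i g w)⁻¹ :=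
  parKnitLY_gaugeY_of_corner_right i _ g U h

/-- ★★ the law for the averaging product through a shared `lev_□`-corner. [cite: Balaban1985BackgroundPropagators, (3.19) p.393, (3.24) p.394, (3.28) p.395, p.409] -/
theorem avgTrCubeY_parKnitCubeY_gaugeY_of_corner {z w : SiteY i} (hc : cornerY i (levCubeY i q w) w = cornerY i (levCubeY i q z) z) :
    avgTrCubeY i q (parKnitCubeY i q) (gaugeY i g U) z w = gSiteY i g z * avgTrCubeY i q (parKnitCubeY i q) U z w * (gSiteY i g w)⁻¹ := by
  unfold avgTrCubeY
  exact parKnitLY_corner_mul_gaugeY i _ g U hc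

/-- ★★ **THE CUBE SEQUENCE's AVERAGING TRANSPORTER AT `parKnitCubeY` IS A CONTOUR VARIABLE ON THE SUPPORT OF THE CUBE COEFFICIENT**:
`avgTrCubeY i □ (parKnitCubeY i □) (U^u) z w = u(z)·avgTrCubeY i □ (parKnitCubeY i □) U z w·u(w)⁻¹` whenever `avgCoeffCubeY i □ z w ≠ 0` — the `hpar`
of the junction's covariance clauses for `Δ′_{a,□}`, `padΔ_{□,Ω₀}`, `G′_{□,S}` at the cube letter (twin of `B9B8KnitLetterCovariance.avgTrY_parKnitY_gaugeY`).
[cite: Balaban1985BackgroundPropagators, (3.24) p.394, (3.28) p.395, Cor. 3.6 p.408 («gauge invariant»), p.409] -/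
theorem avgTrCubeY_parKnitCubeY_gaugeY {z w : SiteY i} (hzw : avgCoeffCubeY i q z w ≠ 0) :
    avgTrCubeY i q (parKnitCubeY i q) (gaugeY i g U) z w = gSiteY i g z * avgTrCubeY i q (parKnitCubeY i q) U z w * (gSiteY i g w)⁻¹ :=
  avgTrCubeY_parKnitCubeY_gaugeY_of_corner i q g U (cornerY_eq_of_avgCoeffCubeY_ne_zero i q hzw)

end Cube

end Literature.MathematicalPhysics.QuantumFieldTheory.Balaban1983to89.Node00.OpsYCubeKnitParCovariance

end
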